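import Mathlib
import HarnessLib
import HarnessLib.Audit
import Summits.ValiantsHypothesis.Statement
import Literature.Computability.AlgebraicComplexity.DeterminantalComplexity
import Literature.Computability.AlgebraicComplexity.DeterminantalComplexityProofs
import Literature.Computability.AlgebraicComplexity.EquivariantDC
import Literature.Computability.AlgebraicComplexity.StandardFamilies
import Literature.Computability.AlgebraicComplexity.VPDeterminantalQPProofs
import Literature.Computability.AlgebraicComplexity.ValiantClasses
import Literature.Computability.AlgebraicComplexity.ValiantConjectureProofs
import HarnessLib.Audit.Status.Attr

/-!
Route: FreeSubtorus

# Route FreeSubtorus — free half-torus — stabilisers of closed torus orbits in the gauge quotient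
give subtorus symmetry at no size cost, and the covering bound survives up to 2^rank

It suffices to show X = OrbitDimensionBound ∧ SubtorusCovering (recombination route, no card
realised). OrbitDimensionBound (FREE HALF-TORUS):
whenever per_n (n ≥ 3) has an affine determinantal representation of size m, it has one of the SAME
size m that is exactly equivariant
(Landsberg–Ressayre lifts in GL_m × GL_m, tree `IsEquivariantDetRepr`) under a subtorus T_Λ of the
row–column torus T' = (ℂˣ)ⁿ × (ℂˣ)ⁿ of
G_per cut out by r ≤ n/2 character equations Λ whose generators have zero row-sum and zero
column-sum (ADMISSIBLE gradings). SubtorusCovering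
(COVERING UP TO 2^rank): every affine representation of per_n equivariant under such a T_Λ has size
≥ C(n,⌊n/2⌋)/2^r. Together:
dc(per_n) ≥ C(n,⌊n/2⌋)/2^(n/2) ≥ (9/8)ⁿ for n ≥ 14, and the exponential-versus-quasi-polynomial
arithmetic of RigidMinimalReps' PROVED item ExpDcGlue (inlined) plus
the hub over proved Literature theorems gives VP_ℂ ≠ VNP_ℂ (`closes`, sorry-free, axioms
propext/choice/Quot.sound). The mechanism behind OrbitDimensionBound is invariant-theoretic and
unconditional
up to one number: Y_m = Rep_m(per_n)//S(GL_m × GL_m) is an affine T'-variety; every T'-orbit closure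
in Y_m contains a CLOSED T'-orbit, the
stabiliser of any of its points contains the subtorus T_Λ (Λ = lattice of realised weights of the
blow-up determinants det(Σ_e T_e ⊗ B_e),
automatically admissible), and stabilising t ∈ T' lift EXACTLY because invariants separate closed
orbits (support PolystableSeparation);
rank Λ = dimension of that closed orbit. So X's first half says precisely: Y_m(per_n) contains a
closed T'-orbit of dimension ≤ n/2.
Lean: `(∀ n : ℕ, 3 ≤ n → ∀ (m : ℕ) (A : Matrix (Fin m) (Fin m) (MvPolynomial (Fin n × Fin n) ℂ)),
Literature.Computability.AlgebraicComplexity.IsAffineDetRepr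
(Literature.Computability.AlgebraicComplexity.perPoly (Fin n) ℂ) A → ∃ (B : Matrix (Fin m) (Fin m)
(MvPolynomial (Fin n × Fin n) ℂ)) (r : ℕ) (Λ : Fin r → (Fin n ⊕ Fin n) → ℤ), r ≤ n / 2 ∧ (∀ i, (∑ k,
Λ i (Sum.inl k)) = 0 ∧ (∑ l, Λ i (Sum.inr l)) = 0) ∧
Literature.Computability.AlgebraicComplexity.IsEquivariantDetRepr (Subgroup.closure {γ :
Matrix.GeneralLinearGroup (Fin n × Fin n) ℂ | ∃ d e : Fin n → ℂˣ, (∀ i, (∏ k, (d k) ^ (Λ i (Sum.inl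
k))) * (∏ l, (e l) ^ (Λ i (Sum.inr l))) = 1) ∧ (γ : Matrix (Fin n × Fin n) (Fin n × Fin n) ℂ) =
Matrix.diagonal (fun p => (d p.1 : ℂ) * (e p.2 : ℂ))})
(Literature.Computability.AlgebraicComplexity.perPoly (Fin n) ℂ) B) ∧ (∀ n : ℕ, 3 ≤ n → ∀ (m r : ℕ)
(Λ : Fin r → (Fin n ⊕ Fin n) → ℤ) (B : Matrix (Fin m) (Fin m) (MvPolynomial (Fin n × Fin n) ℂ)), (∀
i, (∑ k, Λ i (Sum.inl k)) = 0 ∧ (∑ l, Λ i (Sum.inr l)) = 0) →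
Literature.Computability.AlgebraicComplexity.IsEquivariantDetRepr (Subgroup.closure {γ :
Matrix.GeneralLinearGroup (Fin n × Fin n) ℂ | ∃ d e : Fin n → ℂˣ, (∀ i, (∏ k, (d k) ^ (Λ i (Sum.inl
k))) * (∏ l, (e l) ^ (Λ i (Sum.inr l))) = 1) ∧ (γ : Matrix (Fin n × Fin n) (Fin n × Fin n) ℂ) =
Matrix.diagonal (fun p => (d p.1 : ℂ) * (e p.2 : ℂ))})
(Literature.Computability.AlgebraicComplexity.perPoly (Fin n) ℂ) B → Nat.choose n (n / 2) ≤ m * 2 ^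
r)`

## Assembly
PROVED deciding theorem (glue.lean = `closes (h₁ : OrbitDimensionBound) (h₂ : SubtorusCovering) :
ValiantsHypothesis`, sorry-free, lean rc 0, axioms
propext/Classical.choice/Quot.sound): for n ≥ 3 take an optimal representation
(`hasDetRepr_determinantalComplexity_holds`), h₁ gives a T_Λ-equivariant
one of size dc(per_n) with r ≤ n/2 admissible relations, h₂ gives C(n,⌊n/2⌋) ≤ dc(per_n)·2^(n/2);
the inline arithmetic 9ⁿ·2^(n/2)·(n+1) ≤ 16ⁿ (n ≥ 14,
induction) and 2ⁿ ≤ (n+1)·C(n,⌊n/2⌋) (`Nat.choose_le_middle`, `Nat.sum_range_choose`) give (9/8)ⁿ ≤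
dc(per_n) for n ≥ 14; the arithmetic of RigidMinimalReps' PROVED
item ExpDcGlue (gap point N = 2^(2^k) of the qp template; inlined verbatim so the route file imports
Literature modules only) gives ¬IsQPBounded(dc ∘ per),
and the hub over PROVED Literature theorems
(`isQPBounded_determinantalComplexity_of_isVPFamily_holds`, `mem_VP_ofFintype_iff_holds`,
`perFamily_mem_VNP_holds`) concludes VP ℂ ≠ VNP ℂ.

Rationale: WHY THIS LINE. Landsberg–Ressayre prove exponential bounds once about half of G_per is imposed
(LandsbergRessayre2017 Thm 2.8, PROVED in the tree as
`lr_left_equivariant_lower_holds`) and ask (Q 2.2, p.5: "we have no opinion") whether optimal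
expressions can be symmetrised at polynomial cost;
this line makes the TORUS part of that question a theorem of geometric invariant theory with a
single unknown — the dimension of a closed
torus orbit in the gauge quotient — and makes PARTIAL torus symmetry usable by a covering bound that
loses only 2^(rank Λ) (Odlyzko's lemma,
doi:10.1016/0097-3165(88)90046-5: an r-dimensional affine subspace meets {0,1}^N in ≤ 2^r points;
admissibility = pointed grading = the regular
normal form is an honest graded branching program, vonzurGathen1987 / LandsbergRessayre2017 §3).
Imported: reductive GIT on the FIBRE of det over
per (closed orbits, Luna/Mumford separation; KempfNess1979, King1994, MumfordFogartyKirwan1994),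
generation of the left–right invariants of matrix
tuples by blow-up determinants (DomokosZubkov2001, SchofieldVandenBergh2001, DerksenMakam2017 =
arXiv:1512.03393), toric geometry of torus orbit
closures (weight cones, lineality), and a hypercube-counting lemma from combinatorics. Recombined
banked pieces and what each contributed: from
route-ValiantsHypothesis-RigidMinimalReps the move "symmetry from orbit structure"
(OrbitsForceTorus, proved = the dimension-0 case) and the
two-sided covering dictionary (TorusBound), here weakened from FINITENESS of a moduli stratum
(DoublyMinimalFinite, XL, false for size-minimal
reps at n = 3) to an orbit-DIMENSION bound; from route-ValiantsHypothesis-ScaledPencil the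
closed-orbit WLOG inside Rep_m(per_n) (ScaledSameSize,
MinimalRepStable proved) — we read the STABILISER of the closed orbit, not its moment map; from
route-ValiantsHypothesis-ValuativeGCT the
nc-rank / blow-up determinants det(Σ T_e ⊗ A_e) as the coordinates that carry the weights; from the
refutations NoTightInfinity (stmt-5668) and
OptimalUnique (stmt-3735/3738) the lesson that constant-gauge uniqueness is destroyed by
affineness-preserving polynomial gauge — positive-
dimensional S(GL²)-moduli are harmless here unless the TORUS moves them, and on the refuting witness
it does not (Cheapest falsifier, RAN);
from the closed calibration card torus-symmetrisation-is-homogenisation the BB-limit/junk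
obstruction (limits in Rep need "no top-weight
cancellation") — bypassed by taking closed orbits in the affine QUOTIENT, where they always exist
and yield honest representations.

RANKED CRUXES. #2 OrbitDimensionBound (crux) — for n ≥ 3 and every m: if per_n has an affine
determinantal representation of size m, then it has one of size m that is T_Λ-equivariant (exact
GL_m × GL_m lifts) for a subtorus T_Λ = {diag(d_k e_l) : Π_k d_k^(u_k) Π_l e_l^(v_l) = 1 for the r
generators (u;v) of Λ} with r ≤ n/2 and every generator of zero row-sum and zero column-sum. GIT
meaning: the affine T'-variety Y_m(per_n) = Rep_m(per_n)//S(GL_m²) contains a closed T'-orbit of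
dimension ≤ n/2 (from RigidMinimalReps: orbit structure ⇒ symmetry, dim 0 ↦ dim ≤ n/2; from
ScaledPencil: closed orbits in the fibre; from the NoTightInfinity/OptimalUnique refutations: no
finiteness or uniqueness is asked). [difficulty: open-problem] (why it might fail: A rep of per_n of
size < C(n,n/2)/2^(n/2) for infinitely many n refutes it given SubtorusCovering (VH-strength flip);
independently, every closed T'-orbit of Y_m could be ≥ n/2-dimensional: designed commutator junk
with many opposite blow-up weight pairs.) [LandsbergRessayre2017, arXiv:1610.00159, KempfNess1979,
King1994, arXiv:1512.03393, HuttenhainIkenmeyer2016, AlperBogartVelasco2017]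
#3 SubtorusCovering (crux) — for n ≥ 3, every affine determinantal representation of per_n of size m
that is equivariant under an admissible subtorus T_Λ (r generators, zero row- and column-sums)
satisfies C(n,⌊n/2⌋) ≤ m·2^r. Line of proof: regularity (vonzurGathen1987 Thm 3.1, in tree) ⇒
constant part 0 ⊕ I_(m−1); a generic element of the identity component of the lifted T_Λ grades ℂ^m
by ℤ^(2n)/Λ_sat; admissibility ⇒ no nonzero nonnegative vector in Λ_ℝ ⇒ the linear part is acyclic
off the distinguished vertex ⇒ graded ABP; each permutation σ is produced by some path whose depth-d
node has grade [(1_S, 1_σ(S))]; ≥ C(n,d) distinct pairs (S,σ(S)) are forced and one grade class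
holds ≤ 2^r of them (Odlyzko) ⇒ ≥ C(n,d)/2^r nodes at depth d = ⌊n/2⌋ (from
RigidMinimalReps.TorusBound = the case r = 0, generalised; from LR17 Thm 2.8's normal form, proved
in tree). [difficulty: L] (why it might fail: The regular ⇒ graded-ABP dictionary is printed only
for LR's left-monomial group; a two-sided subtorus may lift non-diagonalisably (disconnected T_Λ),
and merged column pairs (r ≈ n/2) might beat C(n,n/2)/2^r by signed inclusion–exclusion.)
[LandsbergRessayre2017, vonzurGathen1987, doi:10.1016/0097-3165(88)90046-5, Grenet2011,
arXiv:1610.00159]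
#9 PolystableSeparation (support) — the mechanism, as known mathematics (reductive GIT +
Domokos–Zubkov/Schofield–Van den Bergh/Derksen–Makam): for every affine representation A of per_n of
size m there is a representation B of size m (a point of the closed S(GL_m²)-orbit in the closure of
the orbit of A) such that for every torus element t = (d,e): if all blow-up determinants agree on
t⋆B and B — det(T₀ ⊗ B₀ + Σ_p d_(p.1) e_(p.2) T_p ⊗ B_p) = (Πd·Πe)^δ · det(T₀ ⊗ B₀ + Σ_p T_p ⊗ B_p)
for all δ and all tuples T of δ×δ matrices (B₀ = constant part, B_p = coefficient matrix of x_p) —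
then t lifts exactly: B(t·x) = g·B·h⁻¹ with g, h ∈ GL_m. With the weight decomposition of the
blow-up determinants this yields OrbitDimensionBound's subtorus T_Λ, Λ = realised weight lattice
(lineal weights have zero row/column sums since both ±χ realised forces full T-degree), rank Λ = dim
of the closed T'-orbit. [difficulty: XL] [arXiv:1512.03393, DomokosZubkov2001,
SchofieldVandenBergh2001, KempfNess1979, King1994, MumfordFogartyKirwan1994]

TWO-LAYER PLAN. Foreseen glued splits (none filed now; k ≤ 3, depth 1). (a) SubtorusCovering ⇐
GradedNormalForm (a T_Λ-equivariant regular representation is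
GL_m²-equivalent to one with constant part 0 ⊕ I and simultaneously weight-graded rows/columns for
the identity component of the lifted T_Λ; reuse
LandsbergRessayreNormalForm / GenericTorusGrading / LRPencilOfMatrix in the tree) → GradedCovering
(a ℤ^(2n)/Λ-graded ABP, Λ admissible of rank r,
computing a polynomial whose support contains all permutation monomials has ≥ C(n,d)/2^r nodes at
depth d: Odlyzko + double counting, provable now)
→ SubtorusCovering. (b) OrbitDimensionBound ⇐ PolystableSeparation (support, known) →
RealisedWeightLattice (the stabiliser of a closed T'-orbit point
contains the common kernel of the realised blow-up weights; admissibility of lineal weights) →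
OrbitDimension (the per-specific number: some closed
T'-orbit of Y_m(per_n) has dimension ≤ n/2) → OrbitDimensionBound. (c) If n/2 proves too greedy: the
same glue works with r ≤ (1−ε)n for any fixed ε
(c = 2^(ε)·(1−o(1)) > 1), and with r ≤ n − √n through `not_isQPBounded` directly (2^√n/poly beats
quasi-polynomial) — restate rank 2, keep rank 3.

KILL CRITERIA. Refutation of SubtorusCovering (an admissibly T_Λ-equivariant representation of some
per_n, n ≥ 3, of size < C(n,⌊n/2⌋)/2^r — first candidates: Ryser/Glynn
hybrids with merged column pairs, n = 6–10) closes the route outright (`refuted:SubtorusCovering`)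
unless the witness only breaks the constant 1 (then restate with
C(n,⌊n/2⌋)/(poly(n)·2^r), same glue with c slightly smaller). Refutation of OrbitDimensionBound as
typed needs a representation of per_n of size m together with a
proof that NO size-m representation is half-torus-equivariant — in practice a theorem "closed
T'-orbits of Y_m(per_n) are all ≥ (1−o(1))·n-dimensional for some
m ≤ qp(n)"; that closes the route (`refuted:OrbitDimensionBound`) and retires the torus half of LR's
Question 2.2 for good (negative knowledge worth having). A proof
elsewhere of dc(per_n) ≤ 2^polylog refutes X. RigidMinimalReps' MinimalRepTorusSymmetric PROVED
implies OrbitDimensionBound with r = 0 (supersede the crux, keep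
SubtorusCovering as the stronger covering statement); TorusBound REFUTED refutes SubtorusCovering at
r = 0 — close together with RigidMinimalReps' engine.

NOT DECOMPOSED YET. The GIT chain behind OrbitDimensionBound (closed orbits exist in affine
quotients; Luna/Mumford separation; Derksen–Makam generation restricted to the fibre by linear
reductivity; weight bookkeeping of F_T under (P,Q,t) ↦ det P^δ det Q^(−δ) F_(t·T)) is recorded in
PolystableSeparation's docstring and NOT itemised: Mathlib has no
GIT, and only the final number (orbit dimension ≤ n/2) is per-specific. No definition item for
"realised weight lattice" or "Y_m" is requested until a prover of
rank 2 asks. The S_n × S_n and transpose parts of G_per are deliberately unused (finite groups give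
no free symmetry this way; that is ProofCarryingSymmetry /
MonotoneRestoration territory). The threshold n/2 is a choice, see Two-layer plan (c).

CHEAPEST FALSIFIER. RAN in this unit (folder bb_defect.py; exact: LP duality makes the
Białynicki-Birula defect of a 1-PS λ = (a;b) equal to W − min over the 7! supported permutations of
the summed minimal entry weights): Grenet's 7×7 representation of per_3 has defect 0 for every λ
(T'-fixed point of Y_7(per_3)); the null-transvection twist
B = Grenet·(1+D) that REFUTED NoTightInfinity and OptimalUnique has defect 0 exactly when ⟨λ,χ'⟩ ≥ 0
and ⟨λ,χ''⟩ ≥ 0, χ' = d₀d₂⁻¹e₀e₁⁻¹, χ'' = e₀e₁⁻¹ (7250 of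
15625 λ in [−2,2]⁶, no exception): the realised characters are admissible and span a POINTED cone,
so closure(T'·[B]) ∋ [Grenet] and OrbitDimensionBound holds on
the refuting family with r = 0. Next cheapest (refuter): the generically TIGHT ≈126-dim component of
Rep_7(per_3) (Cruxes/NoTightInfinity/EvidenceIdeator3.md, kit
j012012) — compute the realised δ = 2 blow-up weights at a certified point and the dimension of its
closed T'-orbit; a closed orbit of dimension ≥ 2 there
REFUTES OrbitDimensionBound at (n,m) = (3,7) (uniform statement needs ≤ ⌊3/2⌋ = 1). SubtorusCovering
bites only past n ≈ 22, so this is the real test.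

NUMBERS. dc(per_3) = 7 (AlperBogartVelasco2017, in tree); n²/2 ≤ dc(per_n) ≤ 2ⁿ − 1
(MignonRessayre2004, Grenet2011, in tree); edc for left-monomial symmetry = 2ⁿ − 1 and for
all of G_per = C(2n,n) − 1 (LandsbergRessayre2017 Thms 2.8/2.1, lower bounds PROVED in tree);
edc_T(det_m) = m via the irregular A(X) = X (arXiv:1610.00159 p.3) —
per_n (n ≥ 3, char ≠ 2) has no irregular representation (vonzurGathen1987). This route's bound:
dc(per_n) ≥ C(n,⌊n/2⌋)/2^(n/2) ≥ 2ⁿ/((n+1)2^(n/2)) ≥ (9/8)ⁿ for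
n ≥ 14; it passes the Mignon–Ressayre value n²/2 only from n ≈ 22 on (C(22,11)/2^11 ≈ 344 > 242).
Effective torus dimension 2n − 1 (the anti-diagonal scalar acts
trivially); "half" = r ≤ n/2 relations. BB-defect data at (3,7): Grenet 0/15625 positive; twisted
Grenet 8375/15625 positive in the standard basis, all explained by
the two characters above. Items at open: 4 (2 cruxes, 1 support, assembly).

DEFINITION REQUESTS. None. Everything is stated over existing declarations: `IsAffineDetRepr`,
`IsEquivariantDetRepr`, `Matrix.linSubstEntries` (EquivariantDC.lean), `perPoly`,
`Matrix.GeneralLinearGroup`, `Subgroup.closure`, `Matrix.kronecker`,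
`MvPolynomial.coeff/constantCoeff`. Cite facts that a prover of PolystableSeparation would want
vendored (to be filed as cite workitems if that support is ever staffed): Derksen–Makam /
Domokos–Zubkov generation of ℂ[M_m^N]^(SL_m×SL_m) by blow-up determinants;
closed orbits and separation in affine quotients by reductive groups.

Novelty: Searches (2026-08-16): tree — all 66 Theses headers (lever list in NOTES.md), 23 open + 113 closed
cards grepped for subtorus|lineality|weight cone|closed orbit|stabiliser|
Derksen|nc-rank (hits only ScaledPencil / kempf-ness-scaled-pencils (moment map, not stabiliser),
RigidMinimalReps (finiteness), ValuativeGCT (Edmonds gap),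
torus-symmetrisation-is-homogenisation (BB limits in Rep)); `lit read arxiv:1508.05788 --grep
Question|optimal|symmetr` (LR17 p.5 Q2.2 read: torus vs permutation part
not separated, no GIT mechanism); `lit read arxiv:1610.00159 --grep equivariant|torus|closed
orbit|stabilizer` (3 lines: edc(det), no quotient argument); `lit read
book:landsberg2017-geometry-complexity-theory --pages 250-252` (§8.11 equivariant dc, proofs of LR
bounds); `lit galaxy search "equivariant determinantal" --star all`
(1: Landsberg's book), `"Landsberg Ressayre"` (0), `"orbit closure of the determinant"` (5, GCT
papers), `"permanent versus determinant"` (6, GCT/survey),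
`"symmetric branching program"` (irrelevant); `lit search --source arxiv "equivariant determinantal
representations permanent symmetry lower bound"` (0);
openalex / s2 HTTP 429 this session; `lit search --source zbmath "Odlyzko subspaces spanned random
selections"` (1: doi:10.1016/0097-3165(88)90046-5); local FTS daemon
down (ConnectionReset) — logged in NOTES.md.
Nearest prior art found: LandsbergRessayre2017 (arXiv:1508.05788: equivariant dc, Q2.2 — symmetry
ASSUMED); arXiv:1610.00159 (IkenmeyerLandsberg2017:  [refs: 10.1016/0097-3165(88, 1508.05788, 1610.00159, arxiv:1508.05788, arxiv:1610.00159, book:landsberg2017-geometry-complexity-theory, doi:10.1016/0097-3165, LandsbergRessayre2017, IkenmeyerLandsberg2017]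

Barriers (technique_class: equivariant-dc, git-orbit-stabiliser, subtorus-covering): - technique_class: equivariant-dc, git-orbit-stabiliser, subtorus-covering
- Literature.Barriers.ValiantsHypothesis.AlgebraicNaturalProofs: the lower bound is for a
syntactically restricted (graded) model and is a support/covering count,
not a distinguisher polynomial on coefficient space; OrbitDimensionBound is an EXISTENCE statement
(a flip), not a largeness property — conceded that "has no
half-torus-equivariant size-m expression" is Zariski-constructible in the coefficients like every dc
statement; the bet is the per-specific GIT input (closed
orbit dimension), not a generic property of random polynomials.
- Literature.Barriers.ValiantsHypothesis.FullRankMultilinear: not a partial-derivative / rank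
method; the graded-ABP count is a covering argument (each node serves
≤ d!(n−d)!·2^r permutations), immune to the Raz–Yehudayoff/AKV n³ cap for syntactically multilinear
CIRCUITS, and claims nothing for ungraded models.
- Literature.Barriers.ValiantsHypothesis.PartialDerivativesDetPerm: N/A — no flattening is
evaluated; det and per are separated by REGULARITY (vzG) plus support
(all permutation monomials), exactly as in LR17. Characteristic-two scope check (barrier file
CharacteristicTwo.lean, `CharacteristicFreeDcLowerBound` NOT asserted):
in char 2 per = det has the fully torus-equivariant size-n representation A(X) = X, so
SubtorusCovering must fail there — it does, because that representation is
irregular and the covering dictionary rests on von zur Gathen's corank-1 regula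

sub-problem: ValiantsHypothesis · status: open · opened planner-plan-lens-ValiantsHypothesis-recomb-v2-g2-0 2026-08-16T17:17:52Z · rev 2 · ledger route-ValiantsHypothesis-FreeSubtorus
GENERATED by the gate from the ledger (D-0016/17). Provers cite these decls: `theorem foo : Summit.ValiantsHypothesis.ValiantsHypothesis.Theses.FreeSubtorus.<Decl> := …` in Summits/ValiantsHypothesis/ValiantsHypothesis/Theorems/<Name>.lean.
-/

namespace Summit.ValiantsHypothesis.ValiantsHypothesis.Theses.FreeSubtorus

open scoped BigOperators Topology Manifold Classical MeasureTheory ProbabilityTheory Matrix InnerProductSpace ComplexConjugate ContinuousMap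
open Filter Set Function TopologicalSpace MeasureTheory

attribute [summit_statement] _root_.ValiantsHypothesis

open Literature.PNP

/-- item stmt-ValiantsHypothesis-16133 · crux · rank 2 · open · by planner
why it might fail: A rep of per_n of size < C(n,n/2)/2^(n/2) for infinitely many n refutes it given SubtorusCovering (VH-strength flip); independently, every closed T'-orbit of Y_m could be ≥ n/2-dimensional: designed commutator junk with many opposite blow-up weight pairs.
sources: LandsbergRessayre2017, arXiv:1610.00159, KempfNess1979, King1994, arXiv:1512.03393, HuttenhainIkenmeyer2016
[crux] for n ≥ 3 and every m: if per_n has an affine determinantal representation of size m, then it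
has one of size m that is T_Λ-equivariant (exact GL_m × GL_m lifts) for a subtorus T_Λ = {diag(d_k
e_l) : Π_k d_k^(u_k) Π_l e_l^(v_l) = 1 for the r generators (u;v) of Λ} with r ≤ n/2 and every
generator of zero row-sum and zero column-sum. GIT meaning: the affine T'-variety Y_m(per_n) =
Rep_m(per_n)//S(GL_m²) contains a closed T'-orbit of dimension ≤ n/2 (from RigidMinimalReps: orbit
structure ⇒ symmetry, dim 0 ↦ dim ≤ n/2; from ScaledPencil: closed orbits in the fibre; from the
NoTightInfinity/OptimalUnique refutations: no finiteness or uniqueness is asked). [difficulty: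
open-problem] -/
@[route_item "route-ValiantsHypothesis-FreeSubtorus", crux]
def OrbitDimensionBound : Prop :=
  ∀ n : ℕ, 3 ≤ n → ∀ (m : ℕ) (A : Matrix (Fin m) (Fin m) (MvPolynomial (Fin n × Fin n) ℂ)), Literature.Computability.AlgebraicComplexity.IsAffineDetRepr (Literature.Computability.AlgebraicComplexity.perPoly (Fin n) ℂ) A → ∃ (B : Matrix (Fin m) (Fin m) (MvPolynomial (Fin n × Fin n) ℂ)) (r : ℕ) (Λ : Fin r → (Fin n ⊕ Fin n) → ℤ), r ≤ n / 2 ∧ (∀ i, (∑ k, Λ i (Sum.inl k)) = 0 ∧ (∑ l, Λ i (Sum.inr l)) = 0) ∧ Literature.Computability.AlgebraicComplexity.IsEquivariantDetRepr (Subgroup.closure {γ : Matrix.GeneralLinearGroup (Fin n × Fin n) ℂ | ∃ d e : Fin n → ℂˣ, (∀ i, (∏ k, (d k) ^ (Λ i (Sum.inl k))) * (∏ l, (e l) ^ (Λ i (Sum.inr l))) = 1) ∧ (γ : Matrix (Fin n × Fin n) (Fin n × Fin n) ℂ) = Matrix.diagonal (fun p => (d p.1 : ℂ) * (e p.2 :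 ℂ))}) (Literature.Computability.AlgebraicComplexity.perPoly (Fin n) ℂ) B

/-- item stmt-ValiantsHypothesis-16134 · crux · rank 3 · closed · proved by Summit.ValiantsHypothesis.ValiantsHypothesis.Theorems.FreeSubtorusSubtorusCovering.subtorusCovering_proof @ 4ab18bbcc1e4 (prover) · by planner
why it might fail: The regular ⇒ graded-ABP dictionary is printed only for LR's left-monomial group; a two-sided subtorus may lift non-diagonalisably (disconnected T_Λ), and merged column pairs (r ≈ n/2) might beat C(n,n/2)/2^r by signed inclusion–exclusion.
sources: LandsbergRessayre2017, vonzurGathen1987, doi:10.1016/0097-3165(88)90046-5, Grenet2011, arXiv:1610.00159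
[crux] for n ≥ 3, every affine determinantal representation of per_n of size m that is equivariant
under an admissible subtorus T_Λ (r generators, zero row- and column-sums) satisfies C(n,⌊n/2⌋) ≤
m·2^r. Line of proof: regularity (vonzurGathen1987 Thm 3.1, in tree) ⇒ constant part 0 ⊕ I_(m−1); a
generic element of the identity component of the lifted T_Λ grades ℂ^m by ℤ^(2n)/Λ_sat;
admissibility ⇒ no nonzero nonnegative vector in Λ_ℝ ⇒ the linear part is acyclic off the
distinguished vertex ⇒ graded ABP; each permutation σ is produced by some path whose depth-d node
has grade [(1_S, 1_σ(S))]; ≥ C(n,d) distinct pairs (S,σ(S)) are forced and one grade class holds ≤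
2^r of them (Odlyzko) ⇒ ≥ C(n,d)/2^r nodes at depth d = ⌊n/2⌋ (from RigidMinimalReps.TorusBound =
the case r = 0, generalised; from LR17 Thm 2.8's normal form, proved in tree). [difficulty: L] -/
@[route_item "route-ValiantsHypothesis-FreeSubtorus", crux]
def SubtorusCovering : Prop :=
  ∀ n : ℕ, 3 ≤ n → ∀ (m r : ℕ) (Λ : Fin r → (Fin n ⊕ Fin n) → ℤ) (B : Matrix (Fin m) (Fin m) (MvPolynomial (Fin n × Fin n) ℂ)), (∀ i, (∑ k, Λ i (Sum.inl k)) = 0 ∧ (∑ l, Λ i (Sum.inr l)) = 0) → Literature.Computability.AlgebraicComplexity.IsEquivariantDetRepr (Subgroup.closure {γ : Matrix.GeneralLinearGroup (Fin n × Fin n) ℂ | ∃ d e : Fin n → ℂˣ, (∀ i, (∏ k, (d k) ^ (Λ i (Sum.inl k))) * (∏ l, (e l) ^ (Λ i (Sum.inr l))) = 1) ∧ (γ : Matrix (Fin n × Fin n) (Fin n × Fin n) ℂ) = Matrix.diagonal (fun p => (d p.1 : ℂ) * (e p.2 : ℂ))}) (Literature.Computability.AlgebraicComplexity.perPoly (Fin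 n) ℂ) B → Nat.choose n (n / 2) ≤ m * 2 ^ r

-- `SubtorusCovering` holds: proved by `Summit.ValiantsHypothesis.ValiantsHypothesis.Theorems.FreeSubtorusSubtorusCovering.subtorusCovering_proof` @ 4ab18bbcc1e4 (its module imports this route file, so no `_holds` link can be stated here).

/-- item stmt-ValiantsHypothesis-16135 · support · rank 9 · open · by planner
sources: arXiv:1512.03393, DomokosZubkov2001, SchofieldVandenBergh2001, KempfNess1979, King1994, MumfordFogartyKirwan1994
[support] the mechanism, as known mathematics (reductive GIT + Domokos–Zubkov/Schofield–Van den
Bergh/Derksen–Makam): for every affine representation A of per_n of size m there is a representation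
B of size m (a point of the closed S(GL_m²)-orbit in the closure of the orbit of A) such that for
every torus element t = (d,e): if all blow-up determinants agree on t⋆B and B — det(T₀ ⊗ B₀ + Σ_p
d_(p.1) e_(p.2) T_p ⊗ B_p) = (Πd·Πe)^δ · det(T₀ ⊗ B₀ + Σ_p T_p ⊗ B_p) for all δ and all tuples T of
δ×δ matrices (B₀ = constant part, B_p = coefficient matrix of x_p) — then t lifts exactly: B(t·x) =
g·B·h⁻¹ with g, h ∈ GL_m. With the weight decomposition of the blow-up determinants this yields
OrbitDimensionBound's subtorus T_Λ, Λ = realised weight lattice (lineal weights have zero row/column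
sums since both ±χ realised forces full T-degree), rank Λ = dim of the closed T'-orbit. [difficulty:
XL] -/
@[route_item "route-ValiantsHypothesis-FreeSubtorus"]
def PolystableSeparation : Prop :=
  ∀ n : ℕ, 3 ≤ n → ∀ (m : ℕ) (A : Matrix (Fin m) (Fin m) (MvPolynomial (Fin n × Fin n) ℂ)), Literature.Computability.AlgebraicComplexity.IsAffineDetRepr (Literature.Computability.AlgebraicComplexity.perPoly (Fin n) ℂ) A → ∃ B : Matrix (Fin m) (Fin m) (MvPolynomial (Fin n × Fin n) ℂ), Literature.Computability.AlgebraicComplexity.IsAffineDetRepr (Literature.Computability.AlgebraicComplexity.perPoly (Fin n) ℂ) B ∧ ∀ (d e : Fin n → ℂˣ) (γ : Matrix.GeneralLinearGroup (Fin n × Fin n) ℂ), (γ : Matrix (Fin n × Fin n) (Fin n × Fin n) ℂ) = Matrix.diagonal (fun p => (d p.1 : ℂ) * (e p.2 : ℂ)) → (∀ (δ : ℕ) (T : Option (Fin n × Fin n) → Matrix (Fin δ) (Fin δ) ℂ), (Matrix.kronecker (T none) (Matrix.of fun i j => MvPolynomial.constantCoeff (B i j)) + ∑ p : Fin n × Fin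 n, ((d p.1 : ℂ) * (e p.2 : ℂ)) • Matrix.kronecker (T (some p)) (Matrix.of fun i j => MvPolynomial.coeff (Finsupp.single p 1) (B i j))).det = ((∏ k, (d k : ℂ)) * ∏ l, (e l : ℂ)) ^ δ * (Matrix.kronecker (T none) (Matrix.of fun i j => MvPolynomial.constantCoeff (B i j)) + ∑ p : Fin n × Fin n, Matrix.kronecker (T (some p)) (Matrix.of fun i j => MvPolynomial.coeff (Finsupp.single p 1) (B i j))).det) → ∃ g h : Matrix.GeneralLinearGroup (Fin m) ℂ, Literature.Computability.AlgebraicComplexity.Matrix.linSubstEntries γ B = (g : Matrix (Fin m) (Fin m) ℂ).map MvPolynomial.C * B * ((h⁻¹ : Matrix.GeneralLinearGroup (Fin m) ℂ) : Matrix (Fin m) (Fin m) ℂ).map MvPolynomial.C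

/-- item stmt-ValiantsHypothesis-16136 · assembly · rank 1 · closed · proved by Summit.ValiantsHypothesis.ValiantsHypothesis.Theorems.FreeSubtorus.assembly_proof (prover) · by planner
sources: LandsbergRessayre2017, Burgisser2000, Valiant1979
[assembly] OrbitDimensionBound → SubtorusCovering → ValiantsHypothesis (literally `closes`). -/
@[route_item "route-ValiantsHypothesis-FreeSubtorus"]
def Assembly : Prop :=
  OrbitDimensionBound → SubtorusCovering → _root_.ValiantsHypothesis

-- `Assembly` holds: proved by `Summit.ValiantsHypothesis.ValiantsHypothesis.Theorems.FreeSubtorus.assembly_proof` (its module imports this route file, so no `_holds` link can be stated here).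

/-! D-0027 §2.1 — DECIDING THEOREM (planner-authored via `route open/edit --closes-file`; by planner-plan-lens-ValiantsHypothesis-recomb-v2-g2-0 2026-08-16T17:17:52Z):
its hypotheses are this route's items and its conclusion the sub-problem Statement (glue_lint), and it elaborates with this file. -/

@[closes "route-ValiantsHypothesis-FreeSubtorus"] theorem closes (h₁ : OrbitDimensionBound) (h₂ : SubtorusCovering) : _root_.ValiantsHypothesis := by
  -- Arithmetic (a): 162^j (2j+2) ≤ 256^j for j ≥ 7.
  have aux_induct : ∀ j : ℕ, 7 ≤ j → 162 ^ j * (2 * j + 2) ≤ 256 ^ j := by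
    intro j hj
    induction j, hj using Nat.le_induction with
    | base => norm_num
    | succ j hj ih =>
      have h1 : 162 * (2 * (j + 1) + 2) ≤ 256 * (2 * j + 2) := by omega
      calc 162 ^ (j + 1) * (2 * (j + 1) + 2) = 162 ^ j * (162 * (2 * (j + 1) + 2)) := by ring
        _ ≤ 162 ^ j * (256 * (2 * j + 2)) := Nat.mul_le_mul_left _ h1
        _ = 256 * (162 ^ j * (2 * j + 2)) := by ring
        _ ≤ 256 * 256 ^ j := Nat.mul_le_mul_left _ ih
        _ = 256 ^ (j + 1) := by ring
  -- Arithmetic (b): 9^n 2^(n/2) (n+1) ≤ 16^n for n ≥ 14.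
  have nine_pow_bound : ∀ n : ℕ, 14 ≤ n → 9 ^ n * 2 ^ (n / 2) * (n + 1) ≤ 16 ^ n := by
    intro n hn
    obtain ⟨j, rfl | rfl⟩ := Nat.even_or_odd' n
    · have hj : 7 ≤ j := by omega
      have h := aux_induct j hj
      have e1 : (2 * j) / 2 = j := by omega
      rw [e1]
      calc 9 ^ (2 * j) * 2 ^ j * (2 * j + 1) = 162 ^ j * (2 * j + 1) := by
              rw [pow_mul]; rw [← mul_pow]; norm_num
        _ ≤ 162 ^ j * (2 * j + 2) := Nat.mul_le_mul_left _ (by omega)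
        _ ≤ 256 ^ j := h
        _ = 16 ^ (2 * j) := by rw [pow_mul]; norm_num
    · have hj : 7 ≤ j := by omega
      have h := aux_induct j hj
      have e1 : (2 * j + 1) / 2 = j := by omega
      rw [e1]
      calc 9 ^ (2 * j + 1) * 2 ^ j * (2 * j + 1 + 1) = 9 * (162 ^ j * (2 * j + 2)) := by
              rw [pow_succ, pow_mul]; rw [show (9:ℕ) ^ 2 = 81 by norm_num]
              rw [show (81:ℕ) ^ j * 9 * 2 ^ j = 9 * (81 ^ j * 2 ^ j) by ring, ← mul_pow]; norm_num; ring
        _ ≤ 9 * 256 ^ j := Nat.mul_le_mul_left _ h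
        _ ≤ 16 * 256 ^ j := Nat.mul_le_mul_right _ (by norm_num)
        _ = 16 ^ (2 * j + 1) := by rw [pow_succ, pow_mul]; norm_num; ring
  -- Arithmetic (c): 2^n ≤ (n+1) C(n, n/2).
  have two_pow_le_choose_middle : ∀ n : ℕ, 2 ^ n ≤ (n + 1) * Nat.choose n (n / 2) := by
    intro n
    have h := Nat.sum_range_choose n
    rw [← h]
    calc ∑ k ∈ Finset.range (n + 1), Nat.choose n k ≤ ∑ _k ∈ Finset.range (n + 1), Nat.choose n (n / 2) :=
          Finset.sum_le_sum fun k _ => Nat.choose_le_middle k n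
      _ = (n + 1) * Nat.choose n (n / 2) := by simp
  -- Step 1: for every n ≥ 3, C(n, n/2) ≤ dc(per_n) · 2^(n/2): an optimal representation exists
  -- (`hasDetRepr_determinantalComplexity_holds`), the free half-torus (h₁) gives an admissibly graded
  -- T_Λ-equivariant representation of the same size with r ≤ n/2 relations, and the covering bound (h₂) applies.
  have hstep : ∀ n : ℕ, 3 ≤ n →
      Nat.choose n (n / 2) ≤ Literature.Computability.AlgebraicComplexity.determinantalComplexity
        (Literature.Computability.AlgebraicComplexity.perPoly (Fin n) ℂ) * 2 ^ (n / 2) := by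
    intro n hn
    obtain ⟨A, hA⟩ := Literature.Computability.AlgebraicComplexity.hasDetRepr_determinantalComplexity_holds
      (Literature.Computability.AlgebraicComplexity.perPoly (Fin n) ℂ)
    obtain ⟨B, r, Λ, hr, hΛ, hB⟩ := h₁ n hn _ A hA
    have h := h₂ n hn _ r Λ B hΛ hB
    calc Nat.choose n (n / 2)
        ≤ Literature.Computability.AlgebraicComplexity.determinantalComplexity
            (Literature.Computability.AlgebraicComplexity.perPoly (Fin n) ℂ) * 2 ^ r := h
      _ ≤ Literature.Computability.AlgebraicComplexity.determinantalComplexity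
            (Literature.Computability.AlgebraicComplexity.perPoly (Fin n) ℂ) * 2 ^ (n / 2) :=
          Nat.mul_le_mul_left _ (Nat.pow_le_pow_right (by norm_num) hr)
  -- Step 2: hence (9/8)^n ≤ dc(per_n) for n ≥ 14 — an eventual exponential lower bound.
  have hexp : ∃ c : ℝ, 1 < c ∧ ∃ n₀ : ℕ, ∀ n ≥ n₀,
      c ^ n ≤ (Literature.Computability.AlgebraicComplexity.determinantalComplexity
        (Literature.Computability.AlgebraicComplexity.perPoly (Fin n) ℂ) : ℝ) := by
    refine ⟨9 / 8, by norm_num, 14, fun n hn => ?_⟩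
    have h14 : (3 : ℕ) ≤ n := le_trans (by norm_num) hn
    have hs := hstep n h14
    have hA := nine_pow_bound n hn
    have hB := two_pow_le_choose_middle n
    set D : ℕ := Literature.Computability.AlgebraicComplexity.determinantalComplexity
      (Literature.Computability.AlgebraicComplexity.perPoly (Fin n) ℂ) with hD
    have hsR : (Nat.choose n (n / 2) : ℝ) ≤ (D : ℝ) * (2 : ℝ) ^ (n / 2) := by exact_mod_cast hs
    have hAR : (9 : ℝ) ^ n * (2 : ℝ) ^ (n / 2) * ((n : ℝ) + 1) ≤ (16 : ℝ) ^ n := by exact_mod_cast hA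
    have hBR : (2 : ℝ) ^ n ≤ ((n : ℝ) + 1) * (Nat.choose n (n / 2) : ℝ) := by exact_mod_cast hB
    have hposn : (0 : ℝ) < (n : ℝ) + 1 := by positivity
    have h8 : (0 : ℝ) < (8 : ℝ) ^ n := by positivity
    have key : (9 / 8 : ℝ) ^ n * ((8 : ℝ) ^ n * (2 : ℝ) ^ (n / 2) * ((n : ℝ) + 1)) ≤
        (D : ℝ) * ((8 : ℝ) ^ n * (2 : ℝ) ^ (n / 2) * ((n : ℝ) + 1)) := by
      have e1 : (9 / 8 : ℝ) ^ n * ((8 : ℝ) ^ n * (2 : ℝ) ^ (n / 2) * ((n : ℝ) + 1)) =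
          (9 : ℝ) ^ n * (2 : ℝ) ^ (n / 2) * ((n : ℝ) + 1) := by
        rw [div_pow]; field_simp
      have e2 : (16 : ℝ) ^ n = (8 : ℝ) ^ n * (2 : ℝ) ^ n := by
        rw [← mul_pow]; norm_num
      rw [e1]
      calc (9 : ℝ) ^ n * (2 : ℝ) ^ (n / 2) * ((n : ℝ) + 1) ≤ (16 : ℝ) ^ n := hAR
        _ = (8 : ℝ) ^ n * (2 : ℝ) ^ n := e2
        _ ≤ (8 : ℝ) ^ n * (((n : ℝ) + 1) * (Nat.choose n (n / 2) : ℝ)) :=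
            mul_le_mul_of_nonneg_left hBR h8.le
        _ ≤ (8 : ℝ) ^ n * (((n : ℝ) + 1) * ((D : ℝ) * (2 : ℝ) ^ (n / 2))) := by
            apply mul_le_mul_of_nonneg_left _ h8.le
            exact mul_le_mul_of_nonneg_left hsR hposn.le
        _ = (D : ℝ) * ((8 : ℝ) ^ n * (2 : ℝ) ^ (n / 2) * ((n : ℝ) + 1)) := by ring
    have hposP : (0 : ℝ) < (8 : ℝ) ^ n * (2 : ℝ) ^ (n / 2) * ((n : ℝ) + 1) := by positivity
    exact le_of_mul_le_mul_right key hposP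
  -- Step 3: exponential ⇒ not quasi-polynomially bounded (the arithmetic of route RigidMinimalReps'
  -- PROVED item ExpDcGlue, Theorems/RigidMinimalRepsExpDcGlue.lean, inlined here so that this file
  -- depends on Literature modules only).
  have log_two_pow_mul_le : ∀ j N : ℕ, Nat.log 2 (2 ^ j * N) ≤ Nat.log 2 N + (j + 1) := by
    intro j N
    have hN : N < 2 ^ (Nat.log 2 N + 1) := Nat.lt_pow_succ_log_self Nat.one_lt_two N
    have h1 : 2 ^ j * N ≤ 2 ^ (Nat.log 2 N + (j + 1)) := by
      calc 2 ^ j * N ≤ 2 ^ j * 2 ^ (Nat.log 2 N + 1) := Nat.mul_le_mul_left _ hN.le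
        _ = 2 ^ (Nat.log 2 N + (j + 1)) := by rw [← pow_add]; congr 1; omega
    calc Nat.log 2 (2 ^ j * N) ≤ Nat.log 2 (2 ^ (Nat.log 2 N + (j + 1))) := Nat.log_mono_right h1
      _ = Nat.log 2 N + (j + 1) := Nat.log_pow Nat.one_lt_two _
  have succ_mul_lt_two_pow_aux : ∀ a i : ℕ, (2 * a + 2 + i + 1) * a < 2 ^ (2 * a + 2 + i) := by
    intro a i
    have ha : a < 2 ^ a := Nat.lt_two_pow_self
    have hj : 2 * a + 2 + i + 1 ≤ 2 ^ (a + 2 + i) := by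
      have h1 : a + 1 + i < 2 ^ (a + 1 + i) := Nat.lt_two_pow_self
      have h2 : 2 ^ (a + 2 + i) = 2 * 2 ^ (a + 1 + i) := by
        rw [← pow_succ']; congr 1; omega
      omega
    calc (2 * a + 2 + i + 1) * a ≤ 2 ^ (a + 2 + i) * a := Nat.mul_le_mul_right a hj
      _ < 2 ^ (a + 2 + i) * 2 ^ a := Nat.mul_lt_mul_of_pos_left ha (Nat.two_pow_pos _)
      _ = 2 ^ (2 * a + 2 + i) := by rw [← pow_add]; congr 1; omega
  have exists_ge_qpExp_lt : ∀ a n₀ : ℕ, ∃ N, n₀ ≤ N ∧ (Nat.log 2 N + a) ^ a < N := by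
    intro a n₀
    have hk : 2 * a + 2 + n₀ < 2 ^ (2 * a + 2 + n₀) := Nat.lt_two_pow_self
    have hkk : 2 ^ (2 * a + 2 + n₀) < 2 ^ (2 ^ (2 * a + 2 + n₀)) := Nat.lt_two_pow_self
    refine ⟨2 ^ (2 ^ (2 * a + 2 + n₀)), by omega, ?_⟩
    rw [Nat.log_pow Nat.one_lt_two]
    have hka : (2 * a + 2 + n₀ + 1) * a < 2 ^ (2 * a + 2 + n₀) := succ_mul_lt_two_pow_aux a n₀
    calc (2 ^ (2 * a + 2 + n₀) + a) ^ a ≤ (2 * 2 ^ (2 * a + 2 + n₀)) ^ a :=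
          Nat.pow_le_pow_left (by omega) a
      _ = 2 ^ ((2 * a + 2 + n₀ + 1) * a) := by rw [← pow_succ', ← pow_mul]
      _ < 2 ^ (2 ^ (2 * a + 2 + n₀)) := Nat.pow_lt_pow_right (by norm_num) hka
  have not_isQPBounded : ¬ Literature.Computability.AlgebraicComplexity.IsQPBounded
      (fun n => Literature.Computability.AlgebraicComplexity.determinantalComplexity
        (Literature.Computability.AlgebraicComplexity.perPoly (Fin n) ℂ)) := by
    obtain ⟨c, hc, n₀, h⟩ := hexp
    rintro ⟨a, ha⟩
    obtain ⟨j, hj⟩ : ∃ j : ℕ, (2 : ℝ) ≤ c ^ (2 ^ j) := by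
      obtain ⟨i, hi⟩ := pow_unbounded_of_one_lt (2 : ℝ) hc
      exact ⟨i, hi.le.trans (pow_le_pow_right₀ hc.le Nat.lt_two_pow_self.le)⟩
    obtain ⟨N, hN, hgap⟩ := exists_ge_qpExp_lt (a + (j + 1)) n₀
    have hNn : n₀ ≤ 2 ^ j * N := hN.trans (Nat.le_mul_of_pos_left N (Nat.two_pow_pos j))
    have hreal : (2 : ℝ) ^ N ≤ (Literature.Computability.AlgebraicComplexity.determinantalComplexity
        (Literature.Computability.AlgebraicComplexity.perPoly (Fin (2 ^ j * N)) ℂ) : ℝ) :=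
      calc (2 : ℝ) ^ N ≤ (c ^ (2 ^ j)) ^ N := pow_le_pow_left₀ (by norm_num) hj N
        _ = c ^ (2 ^ j * N) := (pow_mul c (2 ^ j) N).symm
        _ ≤ _ := h _ hNn
    have hlow : 2 ^ N ≤ Literature.Computability.AlgebraicComplexity.determinantalComplexity
        (Literature.Computability.AlgebraicComplexity.perPoly (Fin (2 ^ j * N)) ℂ) := by
      exact_mod_cast hreal
    have hlog := log_two_pow_mul_le j N
    have hexp' : (Nat.log 2 (2 ^ j * N) + a) ^ a ≤ (Nat.log 2 N + (a + (j + 1))) ^ (a + (j + 1)) :=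
      calc (Nat.log 2 (2 ^ j * N) + a) ^ a ≤ (Nat.log 2 N + (a + (j + 1))) ^ a :=
            Nat.pow_le_pow_left (by omega) a
        _ ≤ (Nat.log 2 N + (a + (j + 1))) ^ (a + (j + 1)) :=
            Nat.pow_le_pow_right (by omega) (by omega)
    have hup : 2 ^ ((Nat.log 2 (2 ^ j * N) + a) ^ a) < 2 ^ N :=
      Nat.pow_lt_pow_right (by norm_num) (hexp'.trans_lt hgap)
    have hqp := ha (2 ^ j * N)
    simp only at hqp
    omega
  -- Step 4: hub (bookkeeping over PROVED Literature theorems, as in routes DetQP/UlrichPadded):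
  -- VP ⇒ qp-bounded dc (BCS97 Cor. (21.40)), the renaming bridge, and Valiant's per ∈ VNP.
  have hnotVP : ¬ Literature.Computability.AlgebraicComplexity.IsVPFamily
      (fun n => Literature.Computability.AlgebraicComplexity.perPoly (Fin n) ℂ) := fun hVP =>
    not_isQPBounded
      (Literature.Computability.AlgebraicComplexity.isQPBounded_determinantalComplexity_of_isVPFamily_holds _ hVP)
  show Literature.Computability.AlgebraicComplexity.VP ℂ ≠ Literature.Computability.AlgebraicComplexity.VNP ℂ
  intro hEq
  apply hnotVP
  have hper : Literature.Computability.AlgebraicComplexity.perFamily ℂ ∈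
      Literature.Computability.AlgebraicComplexity.VP ℂ := by
    rw [hEq]; exact Literature.Computability.AlgebraicComplexity.perFamily_mem_VNP_holds ℂ
  exact (Literature.Computability.AlgebraicComplexity.mem_VP_ofFintype_iff_holds _).1 hper

end Summit.ValiantsHypothesis.ValiantsHypothesis.Theses.FreeSubtorus
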